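import Literature.AnabelianGeometry.EtaleTheta.Discharge.Sec1CuspCyclotomicEquiv
import Literature.AnabelianGeometry.EtaleTheta.GalSectCuspCyclotomicInertia
import HarnessLib

/-!
# [GalSect] §4 / [SemiAnbd] §6 «`I_x ≅ Ẑ(1)`» — census clause C7e (1) `GalSect.IsCyclotomicCusp` HOLDS at every
# joint origin of the [EtTh] §1 theta setting (knit of the §1-interface lane with abc-iut-w5-d029's C7e predicates)

Mochizuki, *The étale theta function …*, Publ. RIMS **45** (2009) [EtTh], Def. 2.1 p. 35 («`D_x → Π^Θ_X` … maps the
inertia group `I_x ⊆ D_x` isomorphically onto `Δ_Θ`», «`1 → Δ_Θ → D̄_x → G_K → 1`»), §1 p. 12 «`(Ẑ(1) ≅) Δ_Θ`»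
[cite: MochizukiEtTh2009, Def 2.1 p.35]; Mochizuki, *Galois sections in absolute anabelian geometry* [GalSect], Nagoya
Math. J. **179** (2005), §4 p. 33 («`1 → I_x → D_x → G_K → 1`, `I_x ≅ Ẑ(1)`») [cite: MochizukiGalSect2005, §4 p.33];
[SemiAnbd] §6 p. 71 «`I_x := D_x ∩ Δ^temp_X` is isomorphic to `Ẑ(1)` … if `x` is a cusp» [cite: MochizukiSemiAnbd2006, §6 p.71].
abc-iut cell, layer L2, seat abc-iut-w5-d051 (gen 5; NV / §1-interface lane); PROOF-ONLY sequel of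
`Discharge/Sec1CuspCyclotomicEquiv.lean` (p459610) and `Discharge/Sec1JointOriginCuspProfile.lean` (p460351).

WHAT.  abc-iut-w5-d029's census item C7e types clause (1) «the cusp is cyclotomic» as the class (c) predicate
`GalSect.IsCyclotomicCusp X x := (cuspPairOf X x).IsCyclotomic X.aug` (`∃ e : I_x ≃ₜ* Ẑ, e(d i d⁻¹) = χ(aug d) · e(i)`)
over the [SemiAnbd] §6 interface `TemperedCurve`, and settles it on the model zoo (positive at the `b`-axis cusp of
`curveχ′`, negative at every commutator-axis carrier `curveκ′`, `curveκ₂`, …).  Gen 4 of this lane DERIVED the same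
`∃ e`-statement on the `ThetaSetting` side from the §1 origin clauses (`IsTateOrigin.exists_cyclotomic_inertia_equiv`).
This file KNITS the two: since `ThetaSetting p extends TemperedCurve p` and `cuspPairOf` is `(D_x, I_x)`,

* `ThetaSetting.isCyclotomicCusp_iff` — `GalSect.IsCyclotomicCusp D.toTemperedCurve x` IS the `ThetaSetting`-side
  `∃ e`-statement (definitional unfolding; recorded so that consumers may rewrite either way);
* **`ThetaSetting.IsTateOrigin.isCyclotomicCusp`** — at `IsEtThOrigin` + `hYcl` + `IsTateOrigin` + R2 (every `N`), every
  cusp `x` with `D_x ⊆ Π^tp_Y` ((P3)) satisfying the cusp law C3 `toTheta(I_x) = Δ_Θ` IS CYCLOTOMIC in abc-iut-w5-d029's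
  sense — the C7e clause (1) PREDICATE ITSELF, by name; joint-origin forms `isCyclotomicCusp_of_origins` (`IsThm16Origin`
  for R2, abc-iut-L2-t7's `CuspLaws` for C3) and `isCyclotomicCusp_of_oncePuncturedData` ((P3) from the bundle);
* `ThetaSetting.IsTateOrigin.map_toTheta_inertia_ne_deltaTheta_of_not_isCyclotomicCusp` — contrapositive LAW: at
  `IsEtThOrigin` + `hYcl` + `IsTateOrigin` + R2, a NON-cyclotomic cusp with (P3) (e.g. any cusp whose inertia is central in
  its decomposition group, `GalSect.not_isCyclotomicCusp_of_conj_eq` — the commutator-axis carriers of the zoo) VIOLATES C3;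
  with `CuspLaws` such a cusp cannot sit at a joint origin at all (`not_isThm16Origin_of_not_isCyclotomicCusp`);
* **`MuTwoSetting.DotCCusp.isCyclotomicInertia_ofTrivialisation_of_origins`** — the C-level form: for a `μ₂`-setting
  `M` whose theta setting is a joint origin with `CuspLaws`, EVERY [EtTh] Thm. 1.10 (iii) cusp datum built by
  abc-iut-w5-d029's `DotCCusp.ofTrivialisation` over a cusp with (P3) IS cyclotomic-inertial
  (`DotCCusp.IsCyclotomicInertia`, via `isCyclotomicInertia_ofTrivialisation_iff`).

CENSUS TOKEN.  C7e clause (1) is a §1 interface LAW at joint origins (`IsEtThOrigin ∧ hYcl ∧ IsThm16Origin ∧ IsTateOrigin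
∧ CuspLaws`); the zoo census of `GalSectCuspCyclotomicInertia` is unchanged (no joint origin is inhabited in the zoo —
the GT-type residual of record of this lane, p455763 / p457976 / p458779 and abc-iut-w5-d165 p447070).
PROOF-ONLY: no definition, no instance, no named fact; nothing restated.  HONEST FRAMING: interface laws over the
frozen root; the origin predicates and C3 are hypotheses inhabited only at models; nothing of [EtTh]/[GalSect]/[SemiAnbd]
is asserted for genuine tempered fundamental groups; no side is taken on [IUTchIII] Cor. 3.12; typed ≠ proved.
-/

noncomputable section

namespace Literature.AnabelianGeometry.EtaleTheta

open Literature.AnabelianGeometry.SemiGraphs Thm16Sub GalSect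
open scoped Pointwise

namespace ThetaSetting

variable {p : ℕ} [Fact p.Prime] {D : ThetaSetting p}

/-! ### 1. The C7e clause (1) predicate at the theta setting's curve -/

/-- **`GalSect.IsCyclotomicCusp` at the theta setting's underlying tempered curve IS the `ThetaSetting`-side
statement** «`∃ e : I_x ≃ₜ* Ẑ` with `e(d w d⁻¹) = χ(aug d) (e w)` for all `d ∈ D_x`, `w ∈ I_x`» (the pair
`cuspPairOf` is `(D_x, I_x)`, the augmentation is `aug`). [cite: MochizukiGalSect2005, §4 p.33] -/
theorem isCyclotomicCusp_iff (x : D.Pt) :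
    IsCyclotomicCusp D.toTemperedCurve x ↔
      ∃ e : ↥(D.inertia x) ≃ₜ* ZHat, ∀ (d : D.PiTemp) (hd : d ∈ D.decomp x) (w : ↥(D.inertia x)),
        e ⟨d * w * d⁻¹, conj_mem_inf_deltaTemp hd w.2⟩ = SettingModel.chi p (D.aug d) (e w) :=
  Iff.rfl

/-- **C7e clause (1) HOLDS at `IsTateOrigin` + R2 + C3.**  At `IsEtThOrigin` + `hYcl` + `IsTateOrigin` + R2 (every `N`),
every cusp `x` with `D_x ⊆ Π^tp_Y` whose inertia maps ONTO `Δ_Θ` (cusp law C3) is cyclotomic in the sense of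
`GalSect.IsCyclotomicCusp` («`I_x ≅ Ẑ(1)` as a `D_x → G_K`-module»). [cite: MochizukiEtTh2009, Def 2.1 p.35] -/
theorem IsTateOrigin.isCyclotomicCusp (hO : D.IsEtThOrigin)
    (hYcl : (D.DtpY.map D.toHat.toMonoidHom).topologicalClosure ≤
      D.DtpY.map D.toHat.toMonoidHom ⊔ (⁅⁅D.DeltaHat, D.DeltaHat⁆, D.DeltaHat⁆).topologicalClosure)
    (hT : D.IsTateOrigin) (hR2 : ∀ N : ℕ+, GtpYNFromCusp D N) {x : D.Pt} (hx : D.IsCusp x)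
    (hP3 : D.decomp x ≤ D.GtpY) (hC3 : (D.inertia x).map D.toTheta = D.DeltaTheta) :
    IsCyclotomicCusp D.toTemperedCurve x :=
  (isCyclotomicCusp_iff x).mpr (hT.exists_cyclotomic_inertia_equiv hO hYcl hR2 hx hP3 hC3)

/-- **Joint-origin form** (`IsThm16Origin` supplies R2, abc-iut-L2-t7's `CuspLaws` supplies C3): at a joint origin every
cusp `x` with `D_x ⊆ Π^tp_Y` is cyclotomic. [cite: MochizukiEtTh2009, Def 2.1 p.35] -/
theorem isCyclotomicCusp_of_origins (hO : D.IsEtThOrigin)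
    (hYcl : (D.DtpY.map D.toHat.toMonoidHom).topologicalClosure ≤
      D.DtpY.map D.toHat.toMonoidHom ⊔ (⁅⁅D.DeltaHat, D.DeltaHat⁆, D.DeltaHat⁆).topologicalClosure)
    (h16 : D.IsThm16Origin) (hT : D.IsTateOrigin) (hL : D.CuspLaws) {x : D.Pt} (hx : D.IsCusp x)
    (hP3 : D.decomp x ≤ D.GtpY) :
    IsCyclotomicCusp D.toTemperedCurve x :=
  (isCyclotomicCusp_iff x).mpr (D.exists_cyclotomic_inertia_equiv_of_origins hO hYcl h16 hT hL hx hP3)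

/-- **… with (P3) from the parameter bundle `OncePuncturedData`**: at a joint origin with `CuspLaws`, EVERY cusp of the
theta setting's curve is cyclotomic. [cite: MochizukiEtTh2009, Def 2.1 p.35] -/
theorem isCyclotomicCusp_of_oncePuncturedData (hO : D.IsEtThOrigin)
    (hYcl : (D.DtpY.map D.toHat.toMonoidHom).topologicalClosure ≤
      D.DtpY.map D.toHat.toMonoidHom ⊔ (⁅⁅D.DeltaHat, D.DeltaHat⁆, D.DeltaHat⁆).topologicalClosure)
    (h16 : D.IsThm16Origin) (hT : D.IsTateOrigin) (hL : D.CuspLaws) (P : D.OncePuncturedData) {x : D.Pt}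
    (hx : D.IsCusp x) :
    IsCyclotomicCusp D.toTemperedCurve x :=
  (isCyclotomicCusp_iff x).mpr (D.exists_cyclotomic_inertia_equiv_of_oncePuncturedData hO hYcl h16 hT hL P hx)

/-! ### 2. Contrapositive laws: non-cyclotomic cusps violate C3 / exclude a joint origin -/

/-- **A non-cyclotomic cusp violates the cusp law C3.**  At `IsEtThOrigin` + `hYcl` + `IsTateOrigin` + R2 (every `N`),
for a cusp `x` with `D_x ⊆ Π^tp_Y` that is NOT cyclotomic (e.g. `I_x` central in `D_x`,
`GalSect.not_isCyclotomicCusp_of_conj_eq`), the inertia does NOT map onto `Δ_Θ`: `toTheta(I_x) ≠ Δ_Θ` (by p451482 it is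
then a PROPER subgroup of `Δ_Θ`). [cite: MochizukiEtTh2009, Def 2.1 p.35] -/
theorem IsTateOrigin.map_toTheta_inertia_ne_deltaTheta_of_not_isCyclotomicCusp (hO : D.IsEtThOrigin)
    (hYcl : (D.DtpY.map D.toHat.toMonoidHom).topologicalClosure ≤
      D.DtpY.map D.toHat.toMonoidHom ⊔ (⁅⁅D.DeltaHat, D.DeltaHat⁆, D.DeltaHat⁆).topologicalClosure)
    (hT : D.IsTateOrigin) (hR2 : ∀ N : ℕ+, GtpYNFromCusp D N) {x : D.Pt} (hx : D.IsCusp x)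
    (hP3 : D.decomp x ≤ D.GtpY) (hnc : ¬ IsCyclotomicCusp D.toTemperedCurve x) :
    (D.inertia x).map D.toTheta ≠ D.DeltaTheta :=
  fun hC3 => hnc (hT.isCyclotomicCusp hO hYcl hR2 hx hP3 hC3)

/-- **… and lies STRICTLY below `Δ_Θ`** (the `⊆`-half of C3 is unconditional at `IsTateOrigin` + R2:
`map_toTheta_inertia_le_deltaTheta`, p451482). [cite: MochizukiEtTh2009, Def 2.1 p.35] -/
theorem IsTateOrigin.map_toTheta_inertia_lt_deltaTheta_of_not_isCyclotomicCusp (hO : D.IsEtThOrigin)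
    (hYcl : (D.DtpY.map D.toHat.toMonoidHom).topologicalClosure ≤
      D.DtpY.map D.toHat.toMonoidHom ⊔ (⁅⁅D.DeltaHat, D.DeltaHat⁆, D.DeltaHat⁆).topologicalClosure)
    (hT : D.IsTateOrigin) (hR2 : ∀ N : ℕ+, GtpYNFromCusp D N) {x : D.Pt} (hx : D.IsCusp x)
    (hP3 : D.decomp x ≤ D.GtpY) (hnc : ¬ IsCyclotomicCusp D.toTemperedCurve x) :
    (D.inertia x).map D.toTheta < D.DeltaTheta :=
  lt_of_le_of_ne (hT.map_toTheta_inertia_le_deltaTheta hR2 ⟨x, hx, 1, (one_smul _ _).symm⟩ hP3)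
    (hT.map_toTheta_inertia_ne_deltaTheta_of_not_isCyclotomicCusp hO hYcl hR2 hx hP3 hnc)

/-- **With `CuspLaws`, a non-cyclotomic cusp with (P3) excludes a joint origin**: at `IsEtThOrigin` + `hYcl` +
`IsTateOrigin` + `CuspLaws`, if some cusp `x` with `D_x ⊆ Π^tp_Y` is not cyclotomic then `IsThm16Origin` FAILS (its R2
clause would force C3 ⇒ cyclotomic).  This is the predicate form of the lane's census «no central (product-type) cusp at
a joint origin» (p455763), now phrased through abc-iut-w5-d029's C7e clause (1). [cite: MochizukiEtTh2009, Def 2.1 p.35] -/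
theorem not_isThm16Origin_of_not_isCyclotomicCusp (hO : D.IsEtThOrigin)
    (hYcl : (D.DtpY.map D.toHat.toMonoidHom).topologicalClosure ≤
      D.DtpY.map D.toHat.toMonoidHom ⊔ (⁅⁅D.DeltaHat, D.DeltaHat⁆, D.DeltaHat⁆).topologicalClosure)
    (hT : D.IsTateOrigin) (hL : D.CuspLaws) {x : D.Pt} (hx : D.IsCusp x) (hP3 : D.decomp x ≤ D.GtpY)
    (hnc : ¬ IsCyclotomicCusp D.toTemperedCurve x) : ¬ D.IsThm16Origin :=
  fun h16 => hnc (D.isCyclotomicCusp_of_origins hO hYcl h16 hT hL hx hP3)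

/-- **Central inertia excludes a joint origin** (the two lanes agree): at `IsEtThOrigin` + `hYcl` + `IsTateOrigin` +
`CuspLaws`, a cusp `x` with `D_x ⊆ Π^tp_Y` whose decomposition group CENTRALISES its inertia rules out `IsThm16Origin` —
abc-iut-w5-d029's generic negative `GalSect.not_isCyclotomicCusp_of_conj_eq` composed with the previous law (cf. the
direct route `not_centralises_inertia_of_origins`, p455763). [cite: NeukirchANT1999, Ch. II Prop. (5.7) (i)] -/
theorem not_isThm16Origin_of_central_inertia (hO : D.IsEtThOrigin)
    (hYcl : (D.DtpY.map D.toHat.toMonoidHom).topologicalClosure ≤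
      D.DtpY.map D.toHat.toMonoidHom ⊔ (⁅⁅D.DeltaHat, D.DeltaHat⁆, D.DeltaHat⁆).topologicalClosure)
    (hT : D.IsTateOrigin) (hL : D.CuspLaws) {x : D.Pt} (hx : D.IsCusp x) (hP3 : D.decomp x ≤ D.GtpY)
    (hcomm : ∀ d ∈ D.decomp x, ∀ i ∈ D.inertia x, d * i * d⁻¹ = i) : ¬ D.IsThm16Origin :=
  D.not_isThm16Origin_of_not_isCyclotomicCusp hO hYcl hT hL hx hP3
    (not_isCyclotomicCusp_of_conj_eq D.toTemperedCurve x hcomm)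

end ThetaSetting

/-! ### 3. The C-level form: [EtTh] Thm. 1.10 (iii)'s cusp data over a joint origin are cyclotomic-inertial -/

namespace MuTwoSetting

namespace DotCCusp

variable {p : ℕ} [Fact p.Prime] {M : MuTwoSetting p}

/-- **C7e clause (1) for `DotCCusp.ofTrivialisation` data over a joint origin.**  Let `M` be a `μ₂`-setting whose theta
setting is a joint origin (`IsEtThOrigin` + `hYcl` + `IsThm16Origin` + `IsTateOrigin`) with abc-iut-L2-t7's `CuspLaws`.
Then for every C-level datum `e`, every `ε_Z`, every cusp `x` with `D_x ⊆ Π^tp_Ẍ` and `D_x ⊆ Π^tp_Y` ((P3)), every base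
splitting `S₀` and every trivialisation `eK`, the [EtTh] Thm. 1.10 (iii) cusp datum `ofTrivialisation e εZ hx hD hS₀ eK`
(abc-iut-w5-d029, p447306) has CYCLOTOMIC inertia (`DotCCusp.IsCyclotomicInertia`) — by
`isCyclotomicInertia_ofTrivialisation_iff` the clause is that of the cusp `x` below, supplied by
`ThetaSetting.isCyclotomicCusp_of_origins`. [cite: MochizukiEtTh2009, Thm 1.10 (iii) p.30] -/
theorem isCyclotomicInertia_ofTrivialisation_of_origins (hO : M.IsEtThOrigin)
    (hYcl : (M.DtpY.map M.toHat.toMonoidHom).topologicalClosure ≤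
      M.DtpY.map M.toHat.toMonoidHom ⊔ (⁅⁅M.DeltaHat, M.DeltaHat⁆, M.DeltaHat⁆).topologicalClosure)
    (h16 : M.IsThm16Origin) (hT : M.IsTateOrigin) (hL : M.CuspLaws)
    (e : M.CLevelData) (εZ : M.GtpC) {x : M.Pt} (hx : M.IsCusp x) (hD : M.decomp x ≤ M.GtpXdd)
    (hP3 : M.decomp x ≤ M.GtpY) {S₀ : Subgroup M.PiTemp} (hS₀ : S₀ ∈ (cuspPairOf M.toTemperedCurve x).splittings)
    (eK : ((cuspPairOf M.toTemperedCurve x).pushforward M.inclX).SplittingClass ≃ KxHat M.toTemperedCurve) :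
    (ofTrivialisation e εZ hx hD hS₀ eK).IsCyclotomicInertia :=
  (isCyclotomicInertia_ofTrivialisation_iff e εZ hx hD hS₀ eK).mpr
    (M.toThetaSetting.isCyclotomicCusp_of_origins hO hYcl h16 hT hL hx hP3)

/-- **… with (P3) from `OncePuncturedData`.** [cite: MochizukiEtTh2009, Thm 1.10 (iii) p.30] -/
theorem isCyclotomicInertia_ofTrivialisation_of_oncePuncturedData (hO : M.IsEtThOrigin)
    (hYcl : (M.DtpY.map M.toHat.toMonoidHom).topologicalClosure ≤
      M.DtpY.map M.toHat.toMonoidHom ⊔ (⁅⁅M.DeltaHat, M.DeltaHat⁆, M.DeltaHat⁆).topologicalClosure)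
    (h16 : M.IsThm16Origin) (hT : M.IsTateOrigin) (hL : M.CuspLaws) (P : M.toThetaSetting.OncePuncturedData)
    (e : M.CLevelData) (εZ : M.GtpC) {x : M.Pt} (hx : M.IsCusp x) (hD : M.decomp x ≤ M.GtpXdd)
    {S₀ : Subgroup M.PiTemp} (hS₀ : S₀ ∈ (cuspPairOf M.toTemperedCurve x).splittings)
    (eK : ((cuspPairOf M.toTemperedCurve x).pushforward M.inclX).SplittingClass ≃ KxHat M.toTemperedCurve) :
    (ofTrivialisation e εZ hx hD hS₀ eK).IsCyclotomicInertia :=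
  isCyclotomicInertia_ofTrivialisation_of_origins hO hYcl h16 hT hL e εZ hx hD (P.decomp_le_ker_toZ x hx) hS₀ eK

end DotCCusp

end MuTwoSetting

end Literature.AnabelianGeometry.EtaleTheta

end
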